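import Mathlib
import Literature.AlgebraicGeometry.Resolution.CobordantGame
import Literature.AlgebraicGeometry.Resolution.CobordantGameRestriction
import Literature.AlgebraicGeometry.Resolution.CobordantChartCoefficients
import Literature.AlgebraicGeometry.Resolution.CobordantChartOneMove
import Literature.AlgebraicGeometry.Resolution.FormalCoordinateChange
import Summits.ResolutionOfSingularities.ResolutionOfSingularities.Theorems.WeightedInvariantGlobalizeLocalDropCanonize
import Summits.ResolutionOfSingularities.ResolutionOfSingularities.Theorems.WeightedInvariantGlobalizeLocalDropRegularGerms

/-!
# Pure powers `u · L^d` of smooth germs are won in one move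

Crux `LocalWeightedDrop` (stmt-ResolutionOfSingularities-8899, route
ResolutionOfSingularities/WeightedInvariant), line `hasse-ridge-face-selection`, registered stub
`stub_purePowerWon` of the skeleton `LocalWeightedDrop`: in every embedding dimension `n + 1 ≥ 1` and
over every field `k`, for a unit `u` (`u(0) ≠ 0`), a SMOOTH germ `L` (`L(0) = 0` and some linear
coefficient `∂L/∂xᵢ(0) ≠ 0`) and any exponent `d`, the germ `u · L^d` has game value `0` in the local
weighted resolution game: `CobordantGame.WonBy k 0 (n + 1) (u * L ^ d)`.  This is the terminal case
of the line (it settles the starting dimension `1` outright and the pure-power branch of the plane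
case).

Proof.
* Units do not change game values (`wonBy_unit_mul_iff`, Canonize file), so it suffices to win `L^d`.
* STRAIGHTENING.  The substitution `Λ = (x₀, …, x_{i-1}, L, x_{i+1}, …)` (the identity with the slot
  `i` replaced by `L`) is a legal formal coordinate change: zero constant terms, and its linear part
  is the identity matrix with row `i` replaced by the linear part of `L`, whose determinant is
  `∂L/∂xᵢ(0) ≠ 0` (`det_linMat_update`, via Cramer's rule `Matrix.cramer_transpose_apply` for the
  identity matrix).  Since `L^d = Λ^*(xᵢ^d)`, the coordinate invariance of game values
  (`wonBy_subst_iff`, Canonize file) reduces the claim to `WonBy k 0 (n + 1) (xᵢ^d)`.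
* ONE MOVE.  `xᵢ^d` is won by the divisorial move `θ = id`, `w = eᵢ` (`isMove_X_single`): it is a
  `w`-homogeneous polynomial of weight `d`, so at every exceptional point `c` off the vertex — which
  forces `cᵢ ≠ 0`, the only positive weight being at `i` — the `s`-exponent of the transform is `d`
  (`CobordantChart.eq_weightedOrder_of_factor`) and the constant term of the `s`-saturated transform
  is `P_d(c) = cᵢ^d ≠ 0` (`CobordantChart.successor_singular_iff`, `CobordantChart.initEval_coe`);
  hence no successor is singular (`wonBy_zero_X_pow`, the `d`-th power version of
  `CobordantGame.wonBy_zero_X_sq`).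
-/

set_option linter.dupNamespace false -- mandated namespace of this single-conjunct summit

namespace Summit.ResolutionOfSingularities.ResolutionOfSingularities.Theorems

open Literature.AlgebraicGeometry.Resolution
open Literature.AlgebraicGeometry.Resolution.CobordantGame

namespace PurePowerWon

variable {k : Type} [Field k]

/-- ONE-MOVE WIN FOR A PURE POWER OF A COORDINATE: `xᵢ^d` (any `d`, any number `n ≥ 1` of
variables) has game value `0` — after the divisorial move `θ = id`, `w = eᵢ` every `s`-saturated
transform at an exceptional point off the vertex (`cᵢ ≠ 0`) has constant term `cᵢ^d ≠ 0`, so no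
successor is singular. -/
theorem wonBy_zero_X_pow {n : ℕ} (i : Fin n) (d : ℕ) :
    WonBy k 0 n (MvPowerSeries.X i ^ d : MvPowerSeries (Fin n) k) := by
  classical
  rw [wonBy_zero_iff]
  refine ⟨MvPowerSeries.X, Pi.single i 1, isMove_X_single i, ?_⟩
  rintro g ⟨c, e, ⟨i', hwi', hci'⟩, hfac, hndvd, hsing⟩
  -- the exceptional point is off the vertex in the slot `i` (the only positive weight)
  have hi' : i' = i := by
    by_contra h
    rw [Pi.single_eq_of_ne h] at hwi'
    exact lt_irrefl 0 hwi'
  subst hi'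
  set w : Fin n → ℕ := Pi.single i' 1 with hwdef
  -- `xᵢ^d` as a `w`-homogeneous polynomial germ of weight `d`
  set P : MvPolynomial (Fin n) k := MvPolynomial.X i' ^ d with hPdef
  have hPcoe : (MvPowerSeries.X i' ^ d : MvPowerSeries (Fin n) k) = (P : MvPowerSeries (Fin n) k) := by
    simp [hPdef, MvPolynomial.coe_pow, MvPolynomial.coe_X]
  have hP : P.IsWeightedHomogeneous w d := by
    have := (MvPolynomial.isWeightedHomogeneous_X k w i').pow d
    simpa [hwdef] using this
  have hP0 : P ≠ 0 := pow_ne_zero d (MvPolynomial.X_ne_zero i')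
  have hP0' : (P : MvPowerSeries (Fin n) k) ≠ 0 := fun h => hP0 (MvPolynomial.coe_eq_zero_iff.mp h)
  -- the literal crux chart is `chart w c'` at the convention point `c'`
  set c' : Fin n → k := fun j => if 0 < w j then c j else 0 with hc'def
  have hc' : ∀ j, w j = 0 → c' j = 0 := fun j hj => by simp [hc'def, hj]
  have hcc : cruxChart k w c = CobordantChart.chart w c' := CobordantChart.cruxChart_eq_chart w c
  rw [hcc, MvPowerSeries.subst_self, id, hPcoe] at hfac
  -- the `s`-exponent of the transform is the weight `d`
  have he : e = d := by
    have h1 := CobordantChart.eq_weightedOrder_of_factor w c' hc' hP0' hfac hndvd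
    rw [CobordantChart.weightedOrder_coe_of_isWeightedHomogeneous w hP hP0] at h1
    exact_mod_cast h1
  subst he
  -- the constant term of the `s`-saturated transform is `P(c') = cᵢ^e ≠ 0`
  obtain ⟨hPa, -, -⟩ := (CobordantChart.successor_singular_iff w c' hc' _ hfac).mp hsing
  rw [CobordantChart.initEval_coe, hP.weightedHomogeneousComponent_same] at hPa
  have hci : c' i' = c i' := by simp [hc'def, hwdef]
  have hev : MvPolynomial.eval c' P = c i' ^ e := by simp [hPdef, hci]
  rw [hev] at hPa
  exact hci' (eq_zero_of_pow_eq_zero hPa)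

/-- THE LINEAR PART OF A STRAIGHTENING SUBSTITUTION: replacing the slot `i` of the identity
substitution `X` by a series `L` gives a substitution whose linear part (the identity matrix with
row `i` replaced by the linear part of `L`) has determinant `∂L/∂xᵢ(0)`. -/
theorem det_linMat_update {m : ℕ} (i : Fin m) (L : MvPowerSeries (Fin m) k) :
    (FormalCoordChange.linMat
      (Function.update (MvPowerSeries.X : Fin m → MvPowerSeries (Fin m) k) i L)).det =
      MvPowerSeries.coeff (Finsupp.single i 1) L := by
  classical
  have hM : FormalCoordChange.linMat
      (Function.update (MvPowerSeries.X : Fin m → MvPowerSeries (Fin m) k) i L) =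
      Matrix.updateRow (1 : Matrix (Fin m) (Fin m) k) i
        (fun j => MvPowerSeries.coeff (Finsupp.single j 1) L) := by
    ext r j
    simp only [FormalCoordChange.linMat, Matrix.of_apply, Matrix.updateRow_apply]
    by_cases h : r = i
    · subst h
      rw [Function.update_self, if_pos rfl]
    · rw [Function.update_of_ne h, if_neg h]
      have h1 := congrFun (congrFun (linMat_X_eq_one (k := k) (n := m)) r) j
      rwa [Matrix.of_apply] at h1
  rw [hM, ← Matrix.cramer_transpose_apply, Matrix.transpose_one, Matrix.cramer_one,
    Module.End.one_apply]

end PurePowerWon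

/-- PURE POWERS ARE WON IN ONE MOVE (every dimension `n + 1 ≥ 1`, every field): for a unit `u`, a
smooth germ `L` (`L(0) = 0`, some linear coefficient `≠ 0`) and any `d`, the germ `u · L^d` is won with
game value `0` — straighten `L` to a coordinate (the substitution `X` with the slot `i` replaced by
`L` is a legal formal coordinate change carrying `xᵢ^d` to `L^d`) and blow up the divisor `xᵢ = 0`
with weight `1`: every `s`-saturated transform is a unit. -/
theorem stub_purePowerWon : ∀ (k : Type) [Field k] (n : ℕ) (u L : MvPowerSeries (Fin (n + 1)) k) (d : ℕ),
    MvPowerSeries.constantCoeff u ≠ 0 → MvPowerSeries.constantCoeff L = 0 →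
    (∃ i, MvPowerSeries.coeff (Finsupp.single i 1) L ≠ 0) →
    CobordantGame.WonBy k 0 (n + 1) (u * L ^ d) := by
  intro k _ n u L d hu hL0 hL1
  obtain ⟨i, hi⟩ := hL1
  rw [wonBy_unit_mul_iff hu]
  -- straighten `L` to the coordinate `xᵢ`
  set Λ : Fin (n + 1) → MvPowerSeries (Fin (n + 1)) k :=
    Function.update (MvPowerSeries.X : Fin (n + 1) → MvPowerSeries (Fin (n + 1)) k) i L with hΛdef
  have hΛ0 : ∀ j, MvPowerSeries.constantCoeff (Λ j) = 0 := by
    intro j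
    by_cases hj : j = i
    · rw [hΛdef, hj, Function.update_self]
      exact hL0
    · rw [hΛdef, Function.update_of_ne hj]
      exact MvPowerSeries.constantCoeff_X j
  have hΛdet : IsUnit (FormalCoordChange.linMat Λ).det := by
    rw [hΛdef, PurePowerWon.det_linMat_update]
    exact isUnit_iff_ne_zero.mpr hi
  have hΛs : MvPowerSeries.HasSubst Λ := MvPowerSeries.hasSubst_of_constantCoeff_zero hΛ0
  have hLd : L ^ d = MvPowerSeries.subst Λ (MvPowerSeries.X i ^ d : MvPowerSeries (Fin (n + 1)) k) := by
    rw [MvPowerSeries.subst_pow hΛs, MvPowerSeries.subst_X hΛs, hΛdef, Function.update_self]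
  rw [hLd, wonBy_subst_iff hΛ0 hΛdet]
  exact PurePowerWon.wonBy_zero_X_pow i d

end Summit.ResolutionOfSingularities.ResolutionOfSingularities.Theorems
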